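import Mathlib
import Summits.KontsevichZagierPeriods.Zeta5Search.Families.DualRateUnbounded
import Summits.KontsevichZagierPeriods.Zeta5Search.Families.DualRateGenuine
import Summits.KontsevichZagierPeriods.Zeta5Search.Families.DualQBridge
import HarnessLib

/-!
# ζ(5) search — Families: **P2's CONJECTURE D holds** — `LeadingCoeffRateIsDualDecay`

HONEST FRAMING: systematic search; no irrationality claim unless certified.  Cell `pub-zeta5`, certifier 2
(cert-2 g9, 2026-08-22).  Real analysis / combinatorics of Brown–Zudilin's leading coefficients; nothing about the
arithmetic of `ζ(5)`; no number of record moves.  No conjecture node is used as a hypothesis; the conjecture node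
`Families/DualConstantTerm.LeadingCoeffRateIsDualDecay` (P2 g6) is PROVED.

THE CASES on Brown–Zudilin's convergence cone `Converges a` (17 non-strict forms):
* GENUINE: `bzDen a ≥ 0` and `dualConstantTerm a ≠ 0` — `Families/DualRateGenuine.leadingCoeffRate_of_ct_ne_zero`
  (D-exact + coefficient asymptotics + ray duality);
* DEGENERATE: otherwise BOTH sides are (junk) zero: `Q(n·a) = 0` for all `n ≥ 1` and the dual ray function is
  unbounded on the simplex so that `raySup = sSup = 0`:
  - some `bzDen a i < 0`: `Q = 0` by the support of cert-2 g8's polynomial family `G(e,t)` (`Families/DualQBridge`: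
    a negative target exponent or a degree bound), unboundedness by the failing gap set `{i}`, `{0,…,4}` (`i = 6`),
    `{1,…,5}` (`i = 7`);
  - `bzDen a ≥ 0`, `dualConstantTerm a = 0`: by Hall's theorem (`Families/DualRateTables`) some Hall condition fails,
    which kills every `dualConstantTerm (n·a)` (weights; D-exact transfers to `Q`) and makes the ray unbounded.
**`leadingCoeffRateIsDualDecay_holds : LeadingCoeffRateIsDualDecay`**, and P2's conditional `recordQRate_eq_of_conjD` becomes
`recordQRate_eq_neg_log_raySup_dual`.  Standard axioms only.
-/

noncomputable section

open MvPolynomial Finset Real Filter Topology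

namespace Summit.KontsevichZagierPeriods.Zeta5Search.Families.Cellular

open Literature.NumberTheory.Irrationality CoeffAsymp DualCT

namespace DualRate

/-! ## The convergence forms we need -/

/-- `Converges a ⇒ bzNum a ≥ 0`. -/
theorem bzNum_nonneg_of_converges {a : Fin 8 → ℤ} (h : BrownZudilin2022.Converges a) : ∀ i, 0 ≤ bzNum a i := by
  have h0 := h (a 0) (by simp [BrownZudilin2022.convergenceForms])
  have h1 := h (a 1) (by simp [BrownZudilin2022.convergenceForms])
  have h2 := h (a 2) (by simp [BrownZudilin2022.convergenceForms])
  have h3 := h (a 3) (by simp [BrownZudilin2022.convergenceForms])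
  have h4 := h (a 4) (by simp [BrownZudilin2022.convergenceForms])
  have h5 := h (a 5) (by simp [BrownZudilin2022.convergenceForms])
  have h6 := h (a 6) (by simp [BrownZudilin2022.convergenceForms])
  have h8 := h (a 0 + a 4 - a 2) (by simp [BrownZudilin2022.convergenceForms])
  intro i
  fin_cases i <;> simp [bzNum] <;> omega

/-- `Converges a ⇒ h₂₇(a) ≥ 0` (the seventeenth form). -/
theorem h27_nonneg_of_converges {a : Fin 8 → ℤ} (h : BrownZudilin2022.Converges a) :
    0 ≤ a 3 + a 6 + 2 * a 7 - a 1 - a 2 - a 5 :=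
  h _ (by simp [BrownZudilin2022.convergenceForms])

/-! ## `Q(n·a) = 0` when some `bzDen a i < 0` -/

open DualQ in
/-- Degree bounds for the factors of `qPoly`: a linear factor. -/
theorem degreeOf_one_add_X_le (j i : Fin 5) : degreeOf j (1 + X i : P5) ≤ if j = i then 1 else 0 := by
  classical
  refine (degreeOf_add_le _ _ _).trans ?_
  rw [degreeOf_one, degreeOf_X]
  simp

open DualQ in
/-- Degree bounds for the factors of `qPoly`: a cubic factor `1 + X_i (1 + X_k)(1 + X_l)`. -/
theorem degreeOf_cubic_le (j i k l : Fin 5) :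
    degreeOf j (1 + X i * (1 + X k) * (1 + X l) : P5) ≤
      (if j = i then 1 else 0) + (if j = k then 1 else 0) + (if j = l then 1 else 0) := by
  classical
  refine (degreeOf_add_le _ _ _).trans ?_
  rw [degreeOf_one]
  simp only [zero_le, max_eq_right]
  refine (degreeOf_mul_le _ _ _).trans (Nat.add_le_add ((degreeOf_mul_le _ _ _).trans (Nat.add_le_add ?_
    (degreeOf_one_add_X_le j k))) (degreeOf_one_add_X_le j l))
  rw [degreeOf_X]

/-- The degree table of the seven factors `F₁,…,F₇` in the five variables. -/
def qDeg : Fin 7 → Fin 5 → ℕ :=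
  ![![0, 0, 1, 0, 0], ![1, 0, 0, 0, 0], ![0, 1, 0, 0, 0], ![0, 0, 0, 1, 0], ![0, 0, 0, 0, 1], ![1, 0, 1, 1, 0],
    ![0, 1, 1, 0, 1]]

open DualQ in
/-- `deg_j F_k ≤ qDeg k j`. -/
theorem degreeOf_qFactor_le (k : Fin 7) (j : Fin 5) : degreeOf j (qFactor k) ≤ qDeg k j := by
  classical
  have l0 := degreeOf_one_add_X_le j 2
  have l1 := degreeOf_one_add_X_le j 0
  have l2 := degreeOf_one_add_X_le j 1
  have l3 := degreeOf_one_add_X_le j 3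
  have l4 := degreeOf_one_add_X_le j 4
  have c5 := degreeOf_cubic_le j 3 0 2
  have c6 := degreeOf_cubic_le j 4 1 2
  fin_cases k <;> fin_cases j <;> simp [qFactor, qDeg] at l0 l1 l2 l3 l4 c5 c6 ⊢ <;> assumption

open DualQ in
/-- The degree of `qPoly e` in the variable `j` is at most `Σ_k e_k · qDeg k j`. -/
theorem degreeOf_qPoly_le (e : Fin 7 → ℕ) (j : Fin 5) :
    degreeOf j (qPoly e) ≤ e 0 * qDeg 0 j + e 1 * qDeg 1 j + e 2 * qDeg 2 j + e 3 * qDeg 3 j + e 4 * qDeg 4 j +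
      e 5 * qDeg 5 j + e 6 * qDeg 6 j := by
  have pw : ∀ k : Fin 7, degreeOf j (qFactor k ^ e k) ≤ e k * qDeg k j :=
    fun k => (degreeOf_pow_le _ _ _).trans (Nat.mul_le_mul_left _ (degreeOf_qFactor_le k j))
  unfold qPoly
  refine (degreeOf_mul_le _ _ _).trans (Nat.add_le_add ((degreeOf_mul_le _ _ _).trans (Nat.add_le_add
    ((degreeOf_mul_le _ _ _).trans (Nat.add_le_add ((degreeOf_mul_le _ _ _).trans (Nat.add_le_add
    ((degreeOf_mul_le _ _ _).trans (Nat.add_le_add ((degreeOf_mul_le _ _ _).trans (Nat.add_le_add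
    (pw 0) (pw 1))) (pw 2))) (pw 3))) (pw 4))) (pw 5))) (pw 6))

open DualQ in
/-- **`G(e,t) = 0` when a target exponent exceeds the degree bound.** -/
theorem G_eq_zero_of_degree (e : Fin 7 → ℕ) (t : Fin 5 → ℤ) (j : Fin 5)
    (hj : ((e 0 * qDeg 0 j + e 1 * qDeg 1 j + e 2 * qDeg 2 j + e 3 * qDeg 3 j + e 4 * qDeg 4 j +
      e 5 * qDeg 5 j + e 6 * qDeg 6 j : ℕ) : ℤ) < t j) :
    G e t = 0 := by
  classical
  unfold G coeffZ
  split_ifs with h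
  · by_contra hne
    have hmem := mem_support_iff.2 hne
    have hle := (monomial_le_degreeOf j hmem).trans (degreeOf_qPoly_le e j)
    simp only [Finsupp.coe_equivFunOnFinite_symm] at hle
    have ht : ((t j).toNat : ℤ) = t j := Int.toNat_of_nonneg (h j)
    have hle' := Int.ofNat_le.2 hle
    rw [ht] at hle'
    exact absurd (lt_of_lt_of_le hj hle') (lt_irrefl _)
  · rfl

/-- **`Q(n·a) = 0` for `n ≥ 1` if `Converges a` and some `bzDen a i < 0`.** -/
theorem QOf_ray_eq_zero_of_bzDen_neg {a : Fin 8 → ℤ} (hC : BrownZudilin2022.Converges a) {i : Fin 8}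
    (hi : bzDen a i < 0) {n : ℕ} (hn : 1 ≤ n) : BrownZudilin2022.QOf (fun k => (n : ℤ) * a k) = 0 := by
  have hA := bzNum_nonneg_of_converges hC
  have h27 := h27_nonneg_of_converges hC
  have hA' : ∀ k, 0 ≤ bzNum (fun k => (n : ℤ) * a k) k := by
    intro k; rw [bzNum_smul]; exact mul_nonneg (by positivity) (hA k)
  have h27' : 0 ≤ (fun k => (n : ℤ) * a k) 3 + (fun k => (n : ℤ) * a k) 6 + 2 * (fun k => (n : ℤ) * a k) 7 -
      (fun k => (n : ℤ) * a k) 1 - (fun k => (n : ℤ) * a k) 2 - (fun k => (n : ℤ) * a k) 5 := by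
    have : (n : ℤ) * a 3 + n * a 6 + 2 * (n * a 7) - n * a 1 - n * a 2 - n * a 5 =
        n * (a 3 + a 6 + 2 * a 7 - a 1 - a 2 - a 5) := by ring
    simp only [this]
    exact mul_nonneg (by positivity) h27
  have habs := DualQ.abs_QOf_eq_G (fun k => (n : ℤ) * a k) hA' h27'
  suffices hG : DualQ.G (DualQ.eOfA fun k => (n : ℤ) * a k) (DualQ.tOfA fun k => (n : ℤ) * a k) = 0 by
    rw [hG] at habs; exact abs_eq_zero.1 habs
  have hn' : (0 : ℤ) < n := by exact_mod_cast hn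
  -- the components of `e(n·a)` and `t(n·a)`
  have a0 := hA 0; have a1 := hA 1; have a3 := hA 3; have a4 := hA 4; have a5 := hA 5; have a6 := hA 6
  have a7 := hA 7
  simp only [bzNum, Matrix.cons_val] at a0 a1 a3 a4 a5 a6 a7
  have n0 : (0 : ℤ) ≤ (n : ℤ) := hn'.le
  have g0 : (0 : ℤ) ≤ ↑n * a 3 + ↑n * a 6 + 2 * (↑n * a 7) - ↑n * a 1 - ↑n * a 2 - ↑n * a 5 := by
    nlinarith [mul_nonneg n0 h27]
  have e0 : (DualQ.eOfA (fun k => (n : ℤ) * a k) 0 : ℤ) = n * (a 3 + a 6 + 2 * a 7 - a 1 - a 2 - a 5) := by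
    simp [DualQ.eOfA, max_eq_left g0]; ring
  have e1 : (DualQ.eOfA (fun k => (n : ℤ) * a k) 1 : ℤ) = n * a 5 := by
    simp [DualQ.eOfA, max_eq_left (mul_nonneg n0 a5)]
  have e2 : (DualQ.eOfA (fun k => (n : ℤ) * a k) 2 : ℤ) = n * a 6 := by
    simp [DualQ.eOfA, max_eq_left (mul_nonneg n0 a7)]
  have e3 : (DualQ.eOfA (fun k => (n : ℤ) * a k) 3 : ℤ) = n * a 3 := by
    simp [DualQ.eOfA, max_eq_left (mul_nonneg n0 a3)]
  have e4 : (DualQ.eOfA (fun k => (n : ℤ) * a k) 4 : ℤ) = n * a 1 := by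
    simp [DualQ.eOfA, max_eq_left (mul_nonneg n0 a1)]
  have e5 : (DualQ.eOfA (fun k => (n : ℤ) * a k) 5 : ℤ) = n * a 4 := by
    simp [DualQ.eOfA, max_eq_left (mul_nonneg n0 a4)]
  have e6 : (DualQ.eOfA (fun k => (n : ℤ) * a k) 6 : ℤ) = n * a 0 := by
    simp [DualQ.eOfA, max_eq_left (mul_nonneg n0 a0)]
  have t0 : DualQ.tOfA (fun k => (n : ℤ) * a k) 0 = n * (a 4 + a 5 - a 7) := by simp [DualQ.tOfA]; ring
  have t1 : DualQ.tOfA (fun k => (n : ℤ) * a k) 1 = n * (a 0 + a 1 + a 5 - a 3 - a 7) := by simp [DualQ.tOfA]; ring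
  have t3 : DualQ.tOfA (fun k => (n : ℤ) * a k) 3 = n * (a 1 + a 2 - a 7) := by simp [DualQ.tOfA]; ring
  have t4 : DualQ.tOfA (fun k => (n : ℤ) * a k) 4 = n * (a 1 + a 2 + a 5 - a 6 - a 7) := by simp [DualQ.tOfA]; ring
  have hdeg : ∀ j : Fin 5, ((DualQ.eOfA (fun k => (n : ℤ) * a k) 0 * qDeg 0 j + DualQ.eOfA (fun k => (n : ℤ) * a k) 1 * qDeg 1 j +
      DualQ.eOfA (fun k => (n : ℤ) * a k) 2 * qDeg 2 j + DualQ.eOfA (fun k => (n : ℤ) * a k) 3 * qDeg 3 j +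
      DualQ.eOfA (fun k => (n : ℤ) * a k) 4 * qDeg 4 j + DualQ.eOfA (fun k => (n : ℤ) * a k) 5 * qDeg 5 j +
      DualQ.eOfA (fun k => (n : ℤ) * a k) 6 * qDeg 6 j : ℕ) : ℤ) =
      (DualQ.eOfA (fun k => (n : ℤ) * a k) 0 : ℤ) * qDeg 0 j + (DualQ.eOfA (fun k => (n : ℤ) * a k) 1 : ℤ) * qDeg 1 j +
      (DualQ.eOfA (fun k => (n : ℤ) * a k) 2 : ℤ) * qDeg 2 j + (DualQ.eOfA (fun k => (n : ℤ) * a k) 3 : ℤ) * qDeg 3 j +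
      (DualQ.eOfA (fun k => (n : ℤ) * a k) 4 : ℤ) * qDeg 4 j + (DualQ.eOfA (fun k => (n : ℤ) * a k) 5 : ℤ) * qDeg 5 j +
      (DualQ.eOfA (fun k => (n : ℤ) * a k) 6 : ℤ) * qDeg 6 j := fun j => by push_cast; ring
  obtain ⟨i, hi8⟩ := i
  interval_cases i
  · -- `i = 0`: `y'`-degree (variable 4): bound `e₄ + e₆ = n(a₁ + a₀) < t₄ = n B₁`
    replace hi : a 0 - a 2 - a 5 + a 6 + a 7 < 0 := hi
    refine G_eq_zero_of_degree _ _ 4 ?_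
    rw [hdeg, e0, e1, e2, e3, e4, e5, e6, t4]
    simp only [qDeg, Matrix.cons_val_zero, Matrix.cons_val_one, Matrix.cons_val]
    push_cast
    have := mul_lt_mul_of_pos_left (show a 1 + a 0 < a 1 + a 2 + a 5 - a 6 - a 7 by linarith) hn'
    linarith
  · -- `i = 1`: `t₄ < 0`
    replace hi : a 1 + a 2 + a 5 - a 6 - a 7 < 0 := hi
    exact DualQ.G_eq_zero_of_neg _ _ 4 (by rw [t4]; exact mul_neg_of_pos_of_neg hn' hi)
  · -- `i = 2`: `z'`-degree (variable 1): bound `e₂ + e₆ = n(a₆ + a₀) < t₁`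
    replace hi : a 3 + a 6 + a 7 - a 1 - a 5 < 0 := hi
    refine G_eq_zero_of_degree _ _ 1 ?_
    rw [hdeg, e0, e1, e2, e3, e4, e5, e6, t1]
    simp only [qDeg, Matrix.cons_val_zero, Matrix.cons_val_one, Matrix.cons_val]
    push_cast
    have := mul_lt_mul_of_pos_left (show a 6 + a 0 < a 0 + a 1 + a 5 - a 3 - a 7 by linarith) hn'
    linarith
  · -- `i = 3`: `t₁ < 0`
    replace hi : a 0 + a 1 + a 5 - a 3 - a 7 < 0 := hi
    exact DualQ.G_eq_zero_of_neg _ _ 1 (by rw [t1]; exact mul_neg_of_pos_of_neg hn' hi)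
  · -- `i = 4`: `y`-degree (variable 3): bound `e₃ + e₅ = n(a₃ + a₄) < t₃`
    replace hi : a 3 + a 4 + a 7 - a 1 - a 2 < 0 := hi
    refine G_eq_zero_of_degree _ _ 3 ?_
    rw [hdeg, e0, e1, e2, e3, e4, e5, e6, t3]
    simp only [qDeg, Matrix.cons_val_zero, Matrix.cons_val_one, Matrix.cons_val]
    push_cast
    have := mul_lt_mul_of_pos_left (show a 3 + a 4 < a 1 + a 2 - a 7 by linarith) hn'
    linarith
  · -- `i = 5`: `t₃ < 0`
    replace hi : a 1 + a 2 - a 7 < 0 := hi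
    exact DualQ.G_eq_zero_of_neg _ _ 3 (by rw [t3]; exact mul_neg_of_pos_of_neg hn' hi)
  · -- `i = 6`: `z`-degree (variable 0): bound `e₁ + e₅ = n(a₅ + a₄) < t₀`
    replace hi : a 7 < 0 := hi
    refine G_eq_zero_of_degree _ _ 0 ?_
    rw [hdeg, e0, e1, e2, e3, e4, e5, e6, t0]
    simp only [qDeg, Matrix.cons_val_zero, Matrix.cons_val_one, Matrix.cons_val]
    push_cast
    have := mul_lt_mul_of_pos_left (show a 5 + a 4 < a 4 + a 5 - a 7 by linarith) hn'
    linarith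
  · -- `i = 7`: `t₀ < 0`
    replace hi : a 4 + a 5 - a 7 < 0 := hi
    exact DualQ.G_eq_zero_of_neg _ _ 0 (by rw [t0]; exact mul_neg_of_pos_of_neg hn' hi)

/-- **Unboundedness when some `bzDen a i < 0`**: `raySup(₈π₈; bzDen a, bzNum a) = 0`. -/
theorem raySup_dual_eq_zero_of_bzDen_neg {a : Fin 8 → ℤ} (hA : ∀ i, 0 ≤ bzNum a i) {i : Fin 8}
    (hi : bzDen a i < 0) : raySup pi8dualInv (bzDen a) (bzNum a) = 0 := by
  have hfilt : ∀ W : Finset (Fin 6), 0 ≤ ∑ e ∈ Finset.univ.filter (fun e : Fin 6 => span6 e ⊆ W), bzNum a (edge6 e) :=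
    fun W => Finset.sum_nonneg fun e _ => hA _
  obtain ⟨i, hi8⟩ := i
  interval_cases i
  · replace hi : bzDen a 0 < 0 := hi
    refine raySup_dual_eq_zero_of_gapFail hA {0} (lt_of_lt_of_le ?_ (hfilt _))
    simpa [gapZ] using hi
  · replace hi : bzDen a 1 < 0 := hi
    refine raySup_dual_eq_zero_of_gapFail hA {1} (lt_of_lt_of_le ?_ (hfilt _))
    simpa [gapZ] using hi
  · replace hi : bzDen a 2 < 0 := hi
    refine raySup_dual_eq_zero_of_gapFail hA {2} (lt_of_lt_of_le ?_ (hfilt _))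
    simpa [gapZ] using hi
  · replace hi : bzDen a 3 < 0 := hi
    refine raySup_dual_eq_zero_of_gapFail hA {3} (lt_of_lt_of_le ?_ (hfilt _))
    simpa [gapZ] using hi
  · replace hi : bzDen a 4 < 0 := hi
    refine raySup_dual_eq_zero_of_gapFail hA {4} (lt_of_lt_of_le ?_ (hfilt _))
    simpa [gapZ] using hi
  · replace hi : bzDen a 5 < 0 := hi
    refine raySup_dual_eq_zero_of_gapFail hA {5} (lt_of_lt_of_le ?_ (hfilt _))
    simpa [gapZ] using hi
  · -- `i = 6`: the gap set `{0,1,2,3,4}` has exponent `bzDen a 6 = a₇`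
    replace hi : bzDen a 6 < 0 := hi
    refine raySup_dual_eq_zero_of_gapFail hA {0, 1, 2, 3, 4} ?_
    have hsub : ({0, 3, 4, 5} : Finset (Fin 6)) ⊆
        Finset.univ.filter (fun e : Fin 6 => span6 e ⊆ ({0, 1, 2, 3, 4} : Finset (Fin 6))) := by
      intro e he
      simp only [Finset.mem_insert, Finset.mem_singleton] at he
      rw [Finset.mem_filter]
      rcases he with rfl | rfl | rfl | rfl <;> simp [span6, Finset.insert_subset_iff]
    refine lt_of_lt_of_le ?_ (Finset.sum_le_sum_of_subset_of_nonneg hsub fun e _ _ => hA _)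
    have h6 : bzDen a 6 = a 7 := rfl
    rw [h6] at hi
    simp [gapZ, edge6, bzNum, bzDen, BrownZudilin2022.b24, BrownZudilin2022.b14, BrownZudilin2022.b57]
    linarith
  · -- `i = 7`: the gap set `{1,2,3,4,5}` has exponent `bzDen a 7 = a₄ + a₅ − a₇`
    replace hi : bzDen a 7 < 0 := hi
    refine raySup_dual_eq_zero_of_gapFail hA {1, 2, 3, 4, 5} ?_
    have hsub : ({0, 1, 2, 3} : Finset (Fin 6)) ⊆
        Finset.univ.filter (fun e : Fin 6 => span6 e ⊆ ({1, 2, 3, 4, 5} : Finset (Fin 6))) := by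
      intro e he
      simp only [Finset.mem_insert, Finset.mem_singleton] at he
      rw [Finset.mem_filter]
      rcases he with rfl | rfl | rfl | rfl <;> simp [span6, Finset.insert_subset_iff]
    refine lt_of_lt_of_le ?_ (Finset.sum_le_sum_of_subset_of_nonneg hsub fun e _ _ => hA _)
    have h7 : bzDen a 7 = a 4 + a 5 - a 7 := rfl
    rw [h7] at hi
    simp [gapZ, edge6, bzNum, bzDen, BrownZudilin2022.b24, BrownZudilin2022.b14, BrownZudilin2022.b57,
      BrownZudilin2022.b35]
    linarith

/-! ## `bzDen a ≥ 0` and `dualConstantTerm a = 0`: a Hall condition fails -/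

/-- On the cone, `dualConstantTerm a = 0` forces a failing Hall condition. -/
theorem exists_hall_fail {a : Fin 8 → ℤ} (hA : ∀ i, 0 ≤ bzNum a i) (hB : ∀ i, 0 ≤ bzDen a i)
    (hct : dualConstantTerm a = 0) :
    ∃ E : Finset (Fin 6), ∑ w ∈ E.biUnion span6, gapExp a w < ∑ e ∈ E, numExp a (edge6 e) := by
  by_contra h
  simp only [not_exists, not_lt] at h
  have hsum : ∑ e : Fin 6, numExp a (edge6 e) = ∑ w, gapExp a w := by
    rw [← sum_numExp_eq_sum_gapExp hA hB, Fin.sum_univ_six]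
    simp [edge6]
  have h1 := coeff_dualSpanProd_pos_of_hall (numExp a) (gapExp a) h hsum
  have h2 : dualConstantTerm a = coeff (Finsupp.equivFunOnFinite.symm (gapExp a)) (dualSpanProd (numExp a)) := rfl
  rw [← h2, hct] at h1
  exact absurd h1 (by norm_num)

/-- A failing Hall condition kills every `dualConstantTerm (n·a)`, `n ≥ 1`. -/
theorem dualConstantTerm_ray_eq_zero {a : Fin 8 → ℤ} (hA : ∀ i, 0 ≤ bzNum a i) (hB : ∀ i, 0 ≤ bzDen a i)
    {E : Finset (Fin 6)} (hE : ∑ w ∈ E.biUnion span6, gapExp a w < ∑ e ∈ E, numExp a (edge6 e)) {n : ℕ}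
    (hn : 1 ≤ n) : dualConstantTerm (fun k => (n : ℤ) * a k) = 0 := by
  have h1 : dualConstantTerm (fun k => (n : ℤ) * a k) =
      coeff (Finsupp.equivFunOnFinite.symm (gapExp fun k => (n : ℤ) * a k)) (dualSpanProd (numExp fun k => (n : ℤ) * a k)) := rfl
  rw [h1, numExp_smul n hA, gapExp_smul n hB]
  refine coeff_dualSpanProd_eq_zero_of_hall_fail _ _ E ?_
  simp only [← Finset.mul_sum]
  exact Nat.mul_lt_mul_of_pos_left hE hn

/-- A failing Hall condition makes the dual ray unbounded. -/
theorem raySup_dual_eq_zero_of_hall_fail {a : Fin 8 → ℤ} (hA : ∀ i, 0 ≤ bzNum a i) (hB : ∀ i, 0 ≤ bzDen a i)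
    {E : Finset (Fin 6)} (hE : ∑ w ∈ E.biUnion span6, gapExp a w < ∑ e ∈ E, numExp a (edge6 e)) :
    raySup pi8dualInv (bzDen a) (bzNum a) = 0 := by
  classical
  refine raySup_dual_eq_zero_of_gapFail hA (E.biUnion span6) ?_
  have hZ : ∀ w : Fin 6, gapZ a w = (gapExp a w : ℤ) := by
    intro w
    fin_cases w <;> simp [gapZ, gapExp] <;> exact hB _
  have hNum : ∀ e : Fin 6, bzNum a (edge6 e) = (numExp a (edge6 e) : ℤ) := fun e => (Int.toNat_of_nonneg (hA _)).symm
  simp_rw [hZ, hNum]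
  have hsub : E ⊆ Finset.univ.filter (fun e : Fin 6 => span6 e ⊆ E.biUnion span6) := by
    intro e he
    rw [Finset.mem_filter]
    exact ⟨Finset.mem_univ _, Finset.subset_biUnion_of_mem span6 he⟩
  calc (∑ w ∈ E.biUnion span6, (gapExp a w : ℤ)) < ∑ e ∈ E, (numExp a (edge6 e) : ℤ) := by exact_mod_cast hE
    _ ≤ ∑ e ∈ Finset.univ.filter (fun e : Fin 6 => span6 e ⊆ E.biUnion span6), (numExp a (edge6 e) : ℤ) :=
        Finset.sum_le_sum_of_subset_of_nonneg hsub fun e _ _ => by positivity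

/-! ## The assembly -/

/-- In the degenerate cases both sides of Conjecture D are zero. -/
theorem tendsto_of_degenerate {a : Fin 8 → ℤ} (hQ : ∀ n : ℕ, 1 ≤ n → BrownZudilin2022.QOf (fun k => (n : ℤ) * a k) = 0)
    (hR : raySup pi8dualInv (bzDen a) (bzNum a) = 0) :
    Tendsto (fun n : ℕ => Real.log |(BrownZudilin2022.QOf (fun i => (n : ℤ) * a i) : ℝ)| / n) atTop
      (𝓝 (-Real.log (raySup pi8dualInv (bzDen a) (bzNum a)))) := by
  rw [hR, Real.log_zero, neg_zero]
  refine tendsto_const_nhds.congr' ?_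
  filter_upwards [eventually_ge_atTop 1] with n hn
  rw [hQ n hn]
  simp

/-- **P2 g6's CONJECTURE D (`Families/DualConstantTerm.LeadingCoeffRateIsDualDecay`) holds**: for every `a` in
Brown–Zudilin's convergence cone, `log|Q(n·a)|/n → −log raySup(₈π₈; bzDen a, bzNum a)`. -/
theorem leadingCoeffRateIsDualDecay_holds : LeadingCoeffRateIsDualDecay := by
  intro a hC
  have hA := bzNum_nonneg_of_converges hC
  by_cases hB : ∀ i, 0 ≤ bzDen a i
  · by_cases hct : dualConstantTerm a = 0
    · obtain ⟨E, hE⟩ := exists_hall_fail hA hB hct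
      refine tendsto_of_degenerate (fun n hn => ?_) (raySup_dual_eq_zero_of_hall_fail hA hB hE)
      have hA' : ∀ k, 0 ≤ bzNum (fun k => (n : ℤ) * a k) k := by
        intro k; rw [bzNum_smul]; exact mul_nonneg (by positivity) (hA k)
      have hB' : ∀ k, 0 ≤ bzDen (fun k => (n : ℤ) * a k) k := by
        intro k; rw [bzDen_smul]; exact mul_nonneg (by positivity) (hB k)
      have h := DualR.dexact_cone _ hA' hB'
      rw [dualConstantTerm_ray_eq_zero hA hB hE hn] at h
      exact abs_eq_zero.1 h
    · exact leadingCoeffRate_of_ct_ne_zero hA hB hct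
  · obtain ⟨i, hi⟩ := not_forall.1 hB
    have hi' : bzDen a i < 0 := lt_of_not_ge hi
    exact tendsto_of_degenerate (fun n hn => QOf_ray_eq_zero_of_bzDen_neg hC hi' hn)
      (raySup_dual_eq_zero_of_bzDen_neg hA hi')

/-- **Consequence (P2 g6's `recordQRate_eq_of_conjD`, now unconditional)**: the printed growth rate of the record
coefficients `lim log|Q(a·n)|/n` (`a = (8,16,10,15,12,16,18,13)`, [BrownZudilin2022, §11]) IS `−log raySup(₈π₈; bzDen a,
bzNum a)`, the algebraic closed form of `Families/ExactDualRecordRayExact`. -/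
theorem recordQRate_eq_neg_log_raySup_dual :
    Brown8.recordQRate =
      -Real.log (raySup pi8dualInv (bzDen BrownZudilin2022.recordVec) (bzNum BrownZudilin2022.recordVec)) :=
  recordQRate_eq_of_conjD leadingCoeffRateIsDualDecay_holds

end DualRate

end Summit.KontsevichZagierPeriods.Zeta5Search.Families.Cellular
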